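import Mathlib
import HarnessLib.Audit
import Summits.PneNP.PneNP.Theorems.PstarGateCasePNorHolders
import Summits.PneNP.PneNP.Theorems.PstarBridgeJoins
import Summits.PneNP.PneNP.Theorems.PstarNorCoreTools
import Summits.PneNP.PneNP.Theorems.PstarNorUnitBridge
import Summits.PneNP.PneNP.Theorems.PstarChordBridgeFundamental

/-!
# One GATED chord, node N1 (CASE P, all other chords (NOR)): the BOUNDARY COUNTS (E2; prover-1 g18)

FRONTIER range-avoidance ladder, rung F-N3 (`stmt-PneNP-19007`), cell `pnp-ideate` (`PstarGateNodesX.GateCasePNorX`; this seat's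
`HOME/pnp-ideate-prover-1/g18/E2-PLAN-v3.md` §3); restricted-model proof complexity — nothing here bears on `P` versus `NP`.

`(r, 3/2)`-boundary accounting with the holders of `PstarGateCasePNorHolders.nor_holders`: a tree edge has at most ONE boundary variable (XOR slots
inner, one AND slot held twice), the gated chord one (`p ∈ g₀`), every other chord two, `g₀` and a gate realiser `g` two each.
* `caseP_nor_count` — on `X = J₀ ∪ {g₀, g}`: **`#(J₀ ∖ N) ≤ #(N − e) + [g ∉ J₀]`**;
* `caseP_nor_count_cycle` — on `X₂ = (D e + e) ∪ {g₀, g}` (if the tree were `D e` alone): **`J₀ ∖ N ≠ D e`**.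
With `PstarGateCasePNor.caseP_nor_units` (`#(N − e) ≤ 2`) the two counts leave of node N1 only `#(N − e) = 2`, `#(J₀ ∖ N) = 3 > #D e = 2`, which the
CONS-T literal structure excludes (`PstarGateFibreRank.avoid_nonempty`: the two edges of `D e` would both hold the same literal) — the assembly is the
successor's `gateCasePNorX_holds`.
-/

set_option linter.dupNamespace false -- `Summit.PneNP.PneNP.…`: summit = sub-problem name (D-0017 single-conjunct layout)

open Finset Module Literature.Computability.Complexity
open Summit.PneNP.PneNP.Theorems.PstarTyped (Typed)
open Summit.PneNP.PneNP.Theorems.PstarSALevel (varSet bdry BoundaryExpanding SimpleOverlap)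
open Summit.PneNP.PneNP.Theorems.PstarGapLinearised (andPair andPair_subset_varSet)
open Summit.PneNP.PneNP.Theorems.PstarGapPeeling (not_mem_varSet_of_private)
open Summit.PneNP.PneNP.Theorems.PstarChordEndgameTools (mem_andPair_iff)
open Summit.PneNP.PneNP.Theorems.PstarCentreFree (vars_mem_varSet)
open Summit.PneNP.PneNP.Theorems.PstarXCore (xverts)
open Summit.PneNP.PneNP.Theorems.PstarCoreBound (XorClosed)
open Summit.PneNP.PneNP.Theorems.PstarReadSumset (V2)
open Summit.PneNP.PneNP.Theorems.PstarChordSystem (ChordSystem)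
open Summit.PneNP.PneNP.Theorems.PstarChordBridgeTools (privs coef)
open Summit.PneNP.PneNP.Theorems.PstarChordBridge (BridgeData sys Solution Lift)
open Summit.PneNP.PneNP.Theorems.PstarChordBridgeCotree (Peelable)
open Summit.PneNP.PneNP.Theorems.PstarChordBridgeForcing (gam freeMon)
open Summit.PneNP.PneNP.Theorems.PstarChordBridgeBasis (qDir polarDir)
open Summit.PneNP.PneNP.Theorems.PstarNorUnitDir (nor_unit_of_dir lit_iff_of_dir)
open Summit.PneNP.PneNP.Theorems.PstarNorCoreTools (not_mem_bdry_of_two card_varSet_inter_bdry_le card_bdry_le_sum)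
open Summit.PneNP.PneNP.Theorems.PstarNorUnitBridge (xor_not_mem_bdry_of_even)
open Summit.PneNP.PneNP.Theorems.PstarGateBridge (GateHyp)
open Summit.PneNP.PneNP.Theorems.PstarGateCasePRegimes (NorCert)
open Summit.PneNP.PneNP.Theorems.PstarGateNodes (GateData ReadAlong AllRead)
open Summit.PneNP.PneNP.Theorems.PstarGateNodesX (GateDataX)
open Summit.PneNP.PneNP.Theorems.PstarGateCasePNorJoins (caseP_nor_structure)
open Summit.PneNP.PneNP.Theorems.PstarBridgeJoins (mem_join_of_not_mem_fundamental)
open Summit.PneNP.PneNP.Theorems.PstarGateCasePNorHolders (not_mem_bdry_of_closed not_mem_bdry_sup card_three_slots nor_holders)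

namespace Summit.PneNP.PneNP.Theorems.PstarGateCasePNorCount

variable {n m : ℕ}

/-- **N1 boundary count**: CASE P, all other chords (NOR) ⟹ `#(J₀ ∖ N) ≤ #(N − e) + [the NOR realiser is a gate]`. -/
theorem caseP_nor_count (I : LocalMap 4 n m) (hI : I.IsPure xorAndPred) (hT : Typed I) (hS : SimpleOverlap I) {r : ℕ}
    (hB : BoundaryExpanding r I) {B : BridgeData n m} {e g₀ : Fin m} {u : Fin n} {κ₀ : ZMod 2} (hD : GateDataX I r B e g₀ u κ₀)
    (hRA : ReadAlong I B e (1, 0)) (hread : AllRead I B e) (hNOR : ∀ e' ∈ B.N, e' ≠ e → NorCert I B (B.D e') (gam B e'))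
    (hne : (B.N.erase e).Nonempty) :
    ∃ g ∈ B.T₁ ∪ freeMon I B.N B.G₁ ∪ (B.T₂ ∪ freeMon I B.N B.G₂),
      (B.J₀ \ B.N).card ≤ (B.N.erase e).card + (if g ∈ B.J₀ then 0 else 1) := by
  classical
  obtain ⟨hXc, hW, hr, hd₁, hd₂, hL, hPe, -, hG, hg₀, hgv, hju, -, -, -, hcoef, hT3, hM0⟩ := id hD
  have he : e ∈ B.N := hG.1
  have heJ : e ∈ B.J₀ := hW.hN he
  have hg₀J : g₀ ∉ B.J₀ := fun h => disjoint_left.1 hd₁ hg₀ h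
  obtain ⟨j₁, j₂, g, σ, τ, hj₁T, hj₂T, hne12, hστ, hσ, hτ, hg, hσg, hτg, hgg₀, hgR, hholder, hg₀slots, hgslots⟩ :=
    nor_holders I hI hT hS hB hD hRA hread hNOR hne
  refine ⟨g, hg, ?_⟩
  set T := B.J₀ \ B.N with hTdef
  have hTJ : T ⊆ B.J₀ := sdiff_subset
  set H : Finset (Fin m) := {j₁, j₂, g₀, g} with hHdef
  have hg₀H : g₀ ∈ H := by simp [hHdef]
  set X : Finset (Fin m) := B.J₀ ∪ {g₀, g} with hXdef
  have hJX : B.J₀ ⊆ X := subset_union_left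
  have hg₀X : g₀ ∈ X := mem_union_right _ (by simp)
  have hgX : g ∈ X := mem_union_right _ (by simp)
  have hHX : H ⊆ X := by
    intro k hk
    simp only [hHdef, mem_insert, mem_singleton] at hk
    rcases hk with rfl | rfl | rfl | rfl
    exacts [hJX (hTJ hj₁T), hJX (hTJ hj₂T), hg₀X, hgX]
  have hXR : X ⊆ B.J₀ ∪ B.G₁ ∪ B.G₂ := by
    refine union_subset (subset_union_left.trans subset_union_left) ?_
    intro k hk
    rw [mem_insert, mem_singleton] at hk
    rcases hk with rfl | rfl
    · exact mem_union_left _ (mem_union_right _ hg₀)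
    · exact hgR
  have hXr : X.card ≤ r := (card_le_card hXR).trans hr
  set Gx : Finset (Fin m) := ({g₀, g} : Finset (Fin m)) \ B.J₀ with hGx
  have hGcard : Gx.card = 1 + (if g ∈ B.J₀ then 0 else 1) := by
    rw [hGx]
    by_cases hgJ : g ∈ B.J₀
    · rw [if_pos hgJ]
      have : ({g₀, g} : Finset (Fin m)) \ B.J₀ = {g₀} := by
        ext k
        simp only [mem_sdiff, mem_insert, mem_singleton]
        constructor
        · rintro ⟨h | h, hk⟩
          · exact h
          · exact absurd (h ▸ hgJ) hk
        · rintro rfl; exact ⟨Or.inl rfl, hg₀J⟩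
      rw [this, card_singleton]
    · rw [if_neg hgJ]
      have : ({g₀, g} : Finset (Fin m)) \ B.J₀ = {g₀, g} := by
        ext k
        simp only [mem_sdiff, mem_insert, mem_singleton]
        constructor
        · rintro ⟨h, -⟩; exact h
        · rintro (rfl | rfl)
          · exact ⟨Or.inl rfl, hg₀J⟩
          · exact ⟨Or.inr rfl, hgJ⟩
      rw [this, card_pair (Ne.symm hgg₀)]
  -- per-output budgets
  let q : Fin m → ℕ := fun k => if k ∈ T then 1 else if k = e then 1 else 2
  have hq : ∀ k ∈ X, (varSet I k ∩ bdry I X).card ≤ q k := by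
    intro k hk
    by_cases hkT : k ∈ T
    · -- a tree edge: XOR slots inner, one AND slot held twice
      simp only [q, if_pos hkT]
      obtain ⟨s, hs, k', hk'H, hne, hv⟩ := hholder k hkT
      have hk' : k' ∈ X := hHX hk'H
      have h := card_varSet_inter_bdry_le I X k {0, 1, s} (fun s' hs' => by
        simp only [mem_insert, mem_singleton] at hs'
        rcases hs' with rfl | rfl | rfl
        · exact not_mem_bdry_of_closed I hXc hJX (hTJ hkT) (by decide)
        · exact not_mem_bdry_of_closed I hXc hJX (hTJ hkT) (by decide)
        · exact not_mem_bdry_of_two I hk hk' (Ne.symm hne) (vars_mem_varSet I k s') hv)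
      rw [card_three_slots hs] at h
      exact h
    · simp only [q, if_neg hkT]
      by_cases hke : k = e
      · -- the gated chord: XOR slots inner, `p` held by `g₀`
        subst hke
        simp only [if_true]
        have hp_g₀ : I.vars k 2 ∈ varSet I g₀ := by
          rcases hgv with ⟨h2, -⟩ | ⟨-, h3⟩
          · exact h2 ▸ vars_mem_varSet I g₀ 2
          · exact h3 ▸ vars_mem_varSet I g₀ 3
        have h := card_varSet_inter_bdry_le I X k {0, 1, 2} (fun s' hs' => by
          simp only [mem_insert, mem_singleton] at hs'
          rcases hs' with rfl | rfl | rfl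
          · exact not_mem_bdry_of_closed I hXc hJX heJ (by decide)
          · exact not_mem_bdry_of_closed I hXc hJX heJ (by decide)
          · exact not_mem_bdry_of_two I hk hg₀X (fun h => hg₀J (h ▸ heJ)) (vars_mem_varSet I k 2) hp_g₀)
        have h3 : ({0, 1, 2} : Finset (Fin 4)).card = 3 := by decide
        rw [h3] at h
        exact h
      · simp only [if_neg hke]
        by_cases hkJ : k ∈ B.J₀
        · -- another chord: XOR slots inner
          have h := card_varSet_inter_bdry_le I X k {0, 1} (fun s' hs' => by
            simp only [mem_insert, mem_singleton] at hs'
            rcases hs' with rfl | rfl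
            · exact not_mem_bdry_of_closed I hXc hJX hkJ (by decide)
            · exact not_mem_bdry_of_closed I hXc hJX hkJ (by decide))
          have h2 : ({0, 1} : Finset (Fin 4)).card = 2 := by decide
          rw [h2] at h
          exact h
        · -- `g₀` or the gate realiser `g`: both AND slots held inside `J₀`
          have hk' : k = g₀ ∨ k = g := by
            rcases mem_union.1 hk with h | h
            · exact absurd h hkJ
            · simpa only [mem_insert, mem_singleton] using h
          have hAND : ∀ s' : Fin 4, 2 ≤ s'.val → ∃ k' ∈ X, k' ≠ k ∧ I.vars k s' ∈ varSet I k' := by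
            intro s' hs'
            have hs23 : s' = 2 ∨ s' = 3 := by
              rcases s' with ⟨s', h4⟩
              simp only [Fin.ext_iff]
              simp only at hs'
              omega
            rcases hk' with rfl | rfl
            · -- `g₀ = (p, u)` or `(u, p)`
              obtain ⟨j₀, hj₀, hju'⟩ := hju
              have hj₀X : j₀ ∈ X := hJX (mem_sdiff.1 hj₀).1
              have hj₀ne : j₀ ≠ k := fun h => hkJ (h ▸ (mem_sdiff.1 hj₀).1)
              have hu_j₀ : u ∈ varSet I j₀ := by rcases hju' with h | h <;> rw [h] <;> exact vars_mem_varSet I j₀ _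
              have hp_e : I.vars e 2 ∈ varSet I e := vars_mem_varSet I e 2
              have hene : e ≠ k := fun h => hkJ (h ▸ heJ)
              rcases hs23 with rfl | rfl
              · rcases hgv with ⟨h2, -⟩ | ⟨h2, -⟩
                · exact ⟨e, hJX heJ, hene, h2 ▸ hp_e⟩
                · exact ⟨j₀, hj₀X, hj₀ne, h2 ▸ hu_j₀⟩
              · rcases hgv with ⟨-, h3⟩ | ⟨-, h3⟩
                · exact ⟨j₀, hj₀X, hj₀ne, h3 ▸ hu_j₀⟩
                · exact ⟨e, hJX heJ, hene, h3 ▸ hp_e⟩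
            · -- the realiser: its AND slots are `σ` and `τ`
              have hj₁ne : j₁ ≠ k := fun h => hkJ (h ▸ hTJ hj₁T)
              have hj₂ne : j₂ ≠ k := fun h => hkJ (h ▸ hTJ hj₂T)
              have hslot : I.vars k s' = σ ∨ I.vars k s' = τ := by
                rcases (mem_andPair_iff I k σ).1 hσg with h1 | h1 <;> rcases (mem_andPair_iff I k τ).1 hτg with h2 | h2
                · exact absurd (h1.trans h2.symm) hστ
                · rcases hs23 with rfl | rfl
                  · exact Or.inl h1.symm
                  · exact Or.inr h2.symm
                · rcases hs23 with rfl | rfl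
                  · exact Or.inr h2.symm
                  · exact Or.inl h1.symm
                · exact absurd (h1.trans h2.symm) hστ
              rcases hslot with h | h
              · exact ⟨j₁, hJX (hTJ hj₁T), hj₁ne, h ▸ andPair_subset_varSet I j₁ hσ⟩
              · exact ⟨j₂, hJX (hTJ hj₂T), hj₂ne, h ▸ andPair_subset_varSet I j₂ hτ⟩
          have h := card_varSet_inter_bdry_le I X k {2, 3} (fun s' hs' => by
            simp only [mem_insert, mem_singleton] at hs'
            have hs2 : 2 ≤ s'.val := by rcases hs' with rfl | rfl <;> decide
            obtain ⟨k', hk'X, hne, hv⟩ := hAND s' hs2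
            exact not_mem_bdry_of_two I hk hk'X (Ne.symm hne) (vars_mem_varSet I k s') hv)
          have h2 : ({2, 3} : Finset (Fin 4)).card = 2 := by decide
          rw [h2] at h
          exact h
  have hbd := card_bdry_le_sum I X q hq
  -- evaluate the budget sum and the size of `X`
  have hTN : Disjoint T B.N := disjoint_sdiff_self_left
  have hJsplit : B.J₀ = T ∪ B.N := by rw [hTdef, sdiff_union_of_subset hW.hN]
  have hNsplit : B.N = insert e (B.N.erase e) := (insert_erase he).symm
  have hq_T : ∑ k ∈ T, q k = T.card := by
    rw [card_eq_sum_ones]; exact sum_congr rfl fun k hk => by simp only [q, if_pos hk]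
  have hq_N : ∑ k ∈ B.N, q k = 1 + 2 * (B.N.erase e).card := by
    rw [hNsplit, sum_insert (notMem_erase e B.N), erase_insert (notMem_erase e B.N)]
    have h1 : q e = 1 := by
      have : e ∉ T := fun h => (mem_sdiff.1 h).2 he
      simp only [q, if_neg this, if_true]
    have h2 : ∑ k ∈ B.N.erase e, q k = 2 * (B.N.erase e).card := by
      rw [mul_comm, card_eq_sum_ones, sum_mul]
      refine sum_congr rfl fun k hk => ?_
      have hkT : k ∉ T := fun h => (mem_sdiff.1 h).2 (mem_of_mem_erase hk)
      simp only [q, if_neg hkT, if_neg (ne_of_mem_erase hk), one_mul]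
    rw [h1, h2]
  set Gx : Finset (Fin m) := ({g₀, g} : Finset (Fin m)) \ B.J₀ with hGx
  have hXsplit : X = B.J₀ ∪ Gx := by rw [hXdef, hGx, union_sdiff_self_eq_union]
  have hdisjG : Disjoint B.J₀ Gx := disjoint_sdiff
  have hq_G : ∑ k ∈ Gx, q k = 2 * Gx.card := by
    rw [mul_comm, card_eq_sum_ones, sum_mul]
    refine sum_congr rfl fun k hk => ?_
    have hkJ : k ∉ B.J₀ := (mem_sdiff.1 hk).2
    have hkT : k ∉ T := fun h => hkJ (hTJ h)
    have hke : k ≠ e := fun h => hkJ (h ▸ heJ)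
    simp only [q, if_neg hkT, if_neg hke, one_mul]
  have hGcard : Gx.card = 1 + (if g ∈ B.J₀ then 0 else 1) := by
    rw [hGx]
    by_cases hgJ : g ∈ B.J₀
    · rw [if_pos hgJ]
      have : ({g₀, g} : Finset (Fin m)) \ B.J₀ = {g₀} := by
        ext k
        simp only [mem_sdiff, mem_insert, mem_singleton]
        constructor
        · rintro ⟨h | h, hk⟩
          · exact h
          · exact absurd (h ▸ hgJ) hk
        · rintro rfl; exact ⟨Or.inl rfl, hg₀J⟩
      rw [this, card_singleton]
    · rw [if_neg hgJ]
      have : ({g₀, g} : Finset (Fin m)) \ B.J₀ = {g₀, g} := by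
        ext k
        simp only [mem_sdiff, mem_insert, mem_singleton]
        constructor
        · rintro ⟨h, -⟩; exact h
        · rintro (rfl | rfl)
          · exact ⟨Or.inl rfl, hg₀J⟩
          · exact ⟨Or.inr rfl, hgJ⟩
      rw [this, card_pair (Ne.symm hgg₀)]
  have hsumX : ∑ k ∈ X, q k = T.card + (1 + 2 * (B.N.erase e).card) + 2 * Gx.card := by
    rw [hXsplit, sum_union hdisjG, hJsplit, sum_union hTN, hq_T, hq_N, hq_G]
  have hcardX : X.card = T.card + (1 + (B.N.erase e).card) + Gx.card := by
    rw [hXsplit, card_union_of_disjoint hdisjG, hJsplit, card_union_of_disjoint hTN, hNsplit,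
      card_insert_of_notMem (notMem_erase e B.N), erase_insert (notMem_erase e B.N)]
    ring
  have hexp := hB X hXr
  rw [hcardX] at hexp
  rw [hsumX] at hbd
  have hcount : T.card ≤ (B.N.erase e).card + (if g ∈ B.J₀ then 0 else 1) := by
    by_cases hgJ : g ∈ B.J₀
    · rw [if_pos hgJ] at hGcard ⊢
      rw [hGcard] at hexp hbd
      omega
    · rw [if_neg hgJ] at hGcard ⊢
      rw [hGcard] at hexp hbd
      omega
  exact hcount

end Summit.PneNP.PneNP.Theorems.PstarGateCasePNorCount
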